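/-
Copyright (c) 2026 the pub-hodgecm-mathlib formalisation cell (harness21).  Prover seat hodgecm-mathlib-F0P3a-p01 (g39), lane A (Unr-K, type U) of the (β₂) road, squad
F0∕P3a ∕ F0∕P3c∕LH4; β₂ WORD #42 leaf ‹LINE-L-A-RAY› (lower line, RAY band); helper lane on h413 = stmt-HodgeConjecture-24833 (count-neutral).  2026-09-05.
-/
import Summits.HodgeConjecture.HodgeConjecture.Theorems.F0P3cDyRamStageOneBDefs             -- ★ DEFS: `mcOfRecord`, `mstarOfRecord`
import HarnessLib

/-!
# Crux `H413`, line LH4 «(D-RAM) FOUR-FRAME» — STAGE-1b, row (2) of `f_{T₊}`, the (β₂) road (R-36), (OFF) residue, THE LOWER LINE, RAY band, DATUM-FREE: «THE SIZE LETTERS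
# OF A LOWER-LINE RAY CELL WITHOUT THE SHARP TRACE BOUND» — the inputs `hμle hanti g1 g2 g3 gsk` of ★ p863761 ∕ ★ `…LowerLineVertexReads` ∕ ★ `…LowerLineCellLiteralReadsRay`,
# read off the (OFF) block scalars on a lower-line cell `2b + ℓ₀ < m`, `j + b + ℓ₀ = jl` of the RAY band `m⋆ ≤ b + ℓ₀` under the floor `m_c ≤ m`, using only `|Θα − α| ≤ 1`

Cell `hodgecm-mathlib` (D-0151), FLOOR 0, crux item H413 = `stmt-HodgeConjecture-24833`, route of record `HCCMUnconditional`; squads F0∕P3a ∕ F0∕P3c∕LH4 ∕ LH7; lane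
`--supports stmt-HodgeConjecture-24833 --as helper` (count-neutral; pays NO tier-0 row).  THEOREMS ONLY (no `def`, no instance, no notation, no `sorry`, default heartbeats);
★-only imports; states NO law.  SCALARS ONLY: a valued field `M`, `ρ Θ : M →+* M`, `α μ ϖM : M`; NO datum.

WHY (F0P3a-p01 (g39) 03:42:48Z lower-line lane-A scope).  LH7-p09 (g3)'s ★ `…LowerLineSizeLettersAbove.lowerLine_sizeLetters_of_le` produces the six size letters on the
WHOLE lower line `d ≤ b` from the M-side datum `IsRamifiedQuadraticDatum Θ ϖM d t` through the SHARP bound `|Θα − α| ≤ |ϖM|^{d−1}` (its §1), which is what `g2 :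
|μ|·|Θα − α| ≤ |α − ρα|·|ϖM|^b·|ϖM|^{m⋆}` needs on the MIX-hi strip.  In lane A (type U: `|α − ρα| = 1`, `|ρα − Θα| < 1`) one has `|Θα − α| = 1` and NO M-side datum
(`M ∕ Fix Θ` is unramified), so `g2` reads `m ≥ b + m⋆` — FALSE on MIX-hi, but TRUE on the RAY band: `m ≥ 2b + ℓ₀ + 1 ≥ b + m⋆ + 1` once `m⋆ ≤ b + ℓ₀`.  THIS FILE states the
seven-tuple of ★ `lowerLine_sizeLetters_of_le` VERBATIM (same order, same spelling) from datum-free scalars: `|ϖM| = e^{−1}`, `|Θα − α| ≤ 1`, `|α − ρα| = 1`, `|μ| = e^{−m}`,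
`|μ − ρμ| = e^{−jl}`, the cell `2b + d%2 < m`, `j + b + d%2 = jl`, the RAY letter `mstarOfRecord d ≤ b + d%2`, the floor `mcOfRecord d ≤ m`.
* HEAD `lowerLine_sizeLetters_of_ray_A` — `hμle : |μ| ≤ |ϖM|^{2b+d%2+1}`, `hanti : |μ − ρμ| = |cc(α − ρα)|·|ϖM|^{b+d%2}`, `g1 : |μ|·|ϖM|^{d−1} ≤ |α − ρα|·|ϖM|^b·|ϖM|^{m⋆}`,
  `g2 : |μ|·|Θα − α| ≤ …`, `g3 : |μ|·|cc| ≤ …`, `gsk : |μ|·|μ − ρμ| ≤ |ϖM|^{m_c}·|cc(α − ρα)|·|ϖM|^b`, and `3d − 2 + d%2 ≤ mcOfRecord d` (`cc = ϖM^j`, `m⋆ = mstarOfRecord d`).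
WHAT IS NOT CLAIMED: anything on the MIX-hi strip `d ≤ b < 2d − 1` (‹LINE-L-A-MIX-HI› stays OPEN); any read, any count.
HONEST LABEL.  Count-neutral valuation bookkeeping; nothing printed is asserted; no census law is stated; `HC_CM` is proved only modulo the 7 printed citations (2 remaining named
inputs: hLiu418 = `stmt-HodgeConjecture-24832`, h413 = `stmt-HodgeConjecture-24833`) until rung 0 closes.
## References
* [Serre1979] J.-P. Serre, *Local Fields*, GTM 67 (1979): Ch. III §6 Prop. 12 (orders of conductor `c`), Ch. V §3 Cor. 3.
* [Kottwitz1986BaseChangeUnits] R. E. Kottwitz, *Base change for unit elements of Hecke algebras*, Compositio Math. 60 (1986): §1 pp. 240–241.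
* [Rogawski1990] J. D. Rogawski, *Automorphic Representations of Unitary Groups in Three Variables*, Ann. of Math. Stud. 123 (1990): §4.9 Prop. 4.9.1 (b) p. 55.
-/

set_option autoImplicit false

noncomputable section

namespace Summit.HodgeConjecture.HodgeConjecture.Cruxes.H413.F0P3cDyRamLowerLineSizeLettersRayA

open scoped Valued WithZero
open WithZero
open Summit.HodgeConjecture.HodgeConjecture.Cruxes.H413.F0P3cDyRamFourFramePieces (mstarOfRecord)
open Summit.HodgeConjecture.HodgeConjecture.Cruxes.H413.F0P3cDyRamStageOneBDefs (mcOfRecord)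

variable {M : Type} [Field M] [Valued M ℤᵐ⁰] {ρ Θ : M →+* M} {α : M}

/-- **HEAD — «THE SIZE LETTERS OF A LOWER-LINE RAY CELL, DATUM-FREE».**  Scalars: `|ϖM| = exp(−1)`, `|Θα − α| ≤ 1`, `|α − ρα| = 1`, `|μ| = exp(−m)`, `|μ − ρμ| = exp(−jl)`;
cell: `2b + d%2 < m`, `j + b + d%2 = jl`; RAY band `mstarOfRecord d ≤ b + d%2`; floor `mcOfRecord d ≤ m`.  THEN, with `cc = ϖM^j`, the seven-tuple of
★ `…LowerLineSizeLettersAbove.lowerLine_sizeLetters_of_le` verbatim: `hμle`, `hanti`, `g1`, `g2`, `g3`, `gsk` (at `n := mcOfRecord d`), `3d − 2 + d%2 ≤ mcOfRecord d`.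
[cite: Serre1979, Ch. III §6 Prop. 12] [cite: Kottwitz1986BaseChangeUnits, §1 pp. 240–241] [cite: Rogawski1990, §4.9 Prop. 4.9.1 (b) p. 55] -/
theorem lowerLine_sizeLetters_of_ray_A {ϖM μ : M} {d m jl j b : ℕ} (hϖ : Valued.v ϖM = exp (-1 : ℤ)) (hΘα : Valued.v (Θ α - α) ≤ 1) (hU : Valued.v (α - ρ α) = 1)
    (hm : Valued.v μ = exp (-(m : ℤ))) (hjl : Valued.v (μ - ρ μ) = exp (-(jl : ℤ)))
    (h2bm : 2 * b + d % 2 < m) (hline : j + b + d % 2 = jl) (hray : mstarOfRecord d ≤ b + d % 2) (hmcm : mcOfRecord d ≤ m) :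
    Valued.v μ ≤ Valued.v ϖM ^ (2 * b + d % 2 + 1) ∧
    Valued.v (μ - ρ μ) = Valued.v (ϖM ^ j * (α - ρ α)) * Valued.v ϖM ^ (b + d % 2) ∧
    Valued.v μ * Valued.v ϖM ^ (d - 1) ≤ Valued.v (α - ρ α) * Valued.v ϖM ^ b * Valued.v ϖM ^ mstarOfRecord d ∧
    Valued.v μ * Valued.v (Θ α - α) ≤ Valued.v (α - ρ α) * Valued.v ϖM ^ b * Valued.v ϖM ^ mstarOfRecord d ∧
    Valued.v μ * Valued.v (ϖM ^ j) ≤ Valued.v (α - ρ α) * Valued.v ϖM ^ b * Valued.v ϖM ^ mstarOfRecord d ∧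
    Valued.v μ * Valued.v (μ - ρ μ) ≤ Valued.v ϖM ^ mcOfRecord d * Valued.v (ϖM ^ j * (α - ρ α)) * Valued.v ϖM ^ b ∧
    3 * d - 2 + d % 2 ≤ mcOfRecord d := by
  have hPn : ∀ n : ℕ, Valued.v ϖM ^ n = exp (-(n : ℤ)) := fun n => by
    rw [hϖ, ← exp_nsmul]; congr 1; simp
  have hms : mstarOfRecord d = d % 2 + 2 * d - 1 := rfl
  have hmc : mcOfRecord d = 2 * ((mstarOfRecord d + d) / 2) := rfl
  have hn : 3 * d - 2 + d % 2 ≤ mcOfRecord d := by rw [hmc, hms]; omega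
  have hmcv : 3 * d - 2 + d % 2 ≤ m := hn.trans hmcm
  refine ⟨?_, ?_, ?_, ?_, ?_, ?_, hn⟩
  · rw [hm, hPn, exp_le_exp]; omega
  · rw [hjl, Valuation.map_mul, hU, mul_one, Valuation.map_pow, hPn, hPn, ← exp_add]; congr 1; omega
  · rw [hm, hU, one_mul, hPn, hPn, hPn, ← exp_add, ← exp_add, exp_le_exp]; omega
  · calc Valued.v μ * Valued.v (Θ α - α)
        ≤ exp (-(m : ℤ)) * 1 := by rw [hm]; exact mul_le_mul' le_rfl hΘα
      _ ≤ Valued.v (α - ρ α) * Valued.v ϖM ^ b * Valued.v ϖM ^ mstarOfRecord d := by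
        rw [mul_one, hU, one_mul, hPn, hPn, ← exp_add, exp_le_exp]; omega
  · rw [hm, hU, one_mul, Valuation.map_pow, hPn, hPn, hPn, ← exp_add, ← exp_add, exp_le_exp]; omega
  · rw [hm, hjl, Valuation.map_mul, hU, mul_one, Valuation.map_pow, hPn, hPn, hPn, ← exp_add, ← exp_add, ← exp_add, exp_le_exp]; omega

end Summit.HodgeConjecture.HodgeConjecture.Cruxes.H413.F0P3cDyRamLowerLineSizeLettersRayA

end
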